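import Summits.SmoothPoincare4.SmoothPoincare4.Theses.SullivanDual
import Literature.Geometry.Symplectic.GromovR4StdModel
import Mathlib.Analysis.Calculus.BumpFunction.InnerProduct

/-!
# SmoothPoincare4 / SullivanDual — the closed model extension (item stmt-SmoothPoincare4-7829)

Settles the support item `ClosedModelExtension` of route SullivanDual (hypothesis `hCME` of its
`closes` theorem): for every homotopy 4-sphere `Σ` and `p ∈ Σ` there are `ε₀ > 0` and a smooth
closed `2`-form `α₀` on `Σ ∖ p` which on the punctured chart-ball of radius `ε₀` at `p` equals the
inverted-chart model `(ι*ω₀)_{e x − e p}(De_x ·, De_x ·)` (`e = extChartAt (𝓡 4) p`,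
`ι z = z / ‖z‖²`), i.e. the non-emptiness `P_ε ≠ ∅` of the standard-on-`B_ε` closed forms used in
the route's assembly for all `ε ≤ ε₀`.

Proof (no Liouville form is needed).  Choose `R > 0` with `closedBall (e p) R ⊆ e.target` and a
smooth bump `χ` on `ℝ⁴` equal to `1` on `closedBall 0 (R/2)` and to `0` off `ball 0 R`, and put
`Φ z = χ (e z − e p) • ι (e z − e p)` for `z` in the chart source and `Φ z = 0` otherwise.  This
`Φ : Σ ∖ p → ℝ⁴` is `C^∞`: on the (open) punctured chart source it is a `C^∞` map of `ℝ⁴ ∖ 0`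
composed with the chart, and it vanishes identically off the compact set
`e.symm '' closedBall (e p) R`.  On the punctured chart-ball of radius `R/2` it IS the inverted
recentred chart `ι ∘ (e − e p)`.  Hence `α₀ := Φ*ω₀` (the tree's pull-back of the constant form
`ω₀`, `Literature.Geometry.Symplectic.stdSymplecticMForm`) is smooth and closed (Warner 2.22–2.23:
`isSmoothForm_stdSymplecticMForm_pullback`, `isClosedForm_stdSymplecticMForm_pullback`, `dω₀ = 0`)
and, by the chain rule `dΦ_x = Dι(e x − e p) ∘ De_x` on the punctured ball
(`hasMFDerivAt_inversion_extChartAt_sub`), equals the model there — verbatim the computation of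
`Literature.Geometry.Symplectic.isSymplecticStandardNearPoint_pullback` without the nondegeneracy
clause.  Everything is proved for an arbitrary smooth Hausdorff 4-manifold `M` and `p ∈ M`.

References: M. Gromov, *Pseudo holomorphic curves in symplectic manifolds*, Invent. Math. 82
(1985), §0.3.C [Gromov1985]; D. McDuff, D. Salamon, *Introduction to Symplectic Topology*, 3rd
ed. (2017), §1.1 [McDuffSalamon2017]; F. W. Warner, GTM 94 (1983), 2.22–2.23 [WarnerGTM94].
-/

noncomputable section

-- the registered namespace `Summit.SmoothPoincare4.SmoothPoincare4.Theorems` repeats a component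
set_option linter.dupNamespace false

open scoped Manifold ContDiff Topology
open Set Filter Metric
open Literature.Geometry.Kaehler Literature.Geometry.Symplectic

namespace Summit.SmoothPoincare4.SmoothPoincare4.Theorems

namespace SullivanDual

variable {M : Type*} [TopologicalSpace M] [T2Space M] [ChartedSpace (EuclideanSpace ℝ (Fin 4)) M]
  [IsManifold (𝓡 4) ∞ M]

/-- **A smooth cut-off of the inverted recentred chart.** For a point `p` of a smooth Hausdorff
4-manifold `M` there are `ε > 0` and a `C^∞` map `Φ : M ∖ {p} → ℝ⁴` which on the punctured
chart-ball of radius `ε` at `p` equals `ι ∘ (e − e p)` (`e = extChartAt (𝓡 4) p`,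
`ι z = z / ‖z‖²`).  Construction: `Φ = (χ • ι) ∘ (e − e p)` on the chart source and `0` off it,
for a bump `χ` supported in a closed chart ball (smooth on the open chart source, where
`e − e p ≠ 0`; identically `0` off the compact image of the closed ball). [folklore] -/
theorem exists_contMDiff_eq_inversion_of_inPuncturedChartBall (p : M) :
    ∃ (ε : ℝ) (Φ : punctured p → EuclideanSpace ℝ (Fin 4)), 0 < ε ∧
      ContMDiff (𝓡 4) (𝓡 4) ∞ Φ ∧
      ∀ x : punctured p, InPuncturedChartBall p ε x →
        Φ x = inversion (extChartAt (𝓡 4) p x.1 - extChartAt (𝓡 4) p p) := by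
  classical
  set e := extChartAt (𝓡 4) p with he
  set c : EuclideanSpace ℝ (Fin 4) := e p with hc
  -- a closed ball inside the chart target
  have ht : e.target ∈ 𝓝 c := extChartAt_target_mem_nhds (I := 𝓡 4) p
  obtain ⟨R, hR, hRt⟩ := Metric.nhds_basis_closedBall.mem_iff.1 ht
  -- the bump function, `= 1` on `closedBall 0 (R/2)`, `= 0` off `ball 0 R`
  let χ : ContDiffBump (0 : EuclideanSpace ℝ (Fin 4)) := ⟨R / 2, R, by positivity, by linarith⟩
  -- the cut-off inversion, recentred at `c = e p`
  let Ψ : EuclideanSpace ℝ (Fin 4) → EuclideanSpace ℝ (Fin 4) := fun y =>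
    χ (y - c) • inversion (y - c)
  let Φ : punctured p → EuclideanSpace ℝ (Fin 4) := fun z =>
    if z.1 ∈ (chartAt (EuclideanSpace ℝ (Fin 4)) p).source then Ψ (e z.1) else 0
  -- the open punctured chart source and the closed support region
  let U₀ : Set (punctured p) := Subtype.val ⁻¹' (chartAt (EuclideanSpace ℝ (Fin 4)) p).source
  have hU₀ : IsOpen U₀ :=
    (chartAt (EuclideanSpace ℝ (Fin 4)) p).open_source.preimage continuous_subtype_val
  let K : Set (punctured p) := Subtype.val ⁻¹' (e.symm '' closedBall c R)
  have hK : IsClosed K := by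
    have hcpt : IsCompact (e.symm '' closedBall c R) :=
      (isCompact_closedBall c R).image_of_continuousOn
        ((continuousOn_extChartAt_symm (I := 𝓡 4) p).mono hRt)
    exact hcpt.isClosed.preimage continuous_subtype_val
  have hE : ContMDiffOn (𝓡 4) 𝓘(ℝ, EuclideanSpace ℝ (Fin 4)) ∞ (fun z : punctured p => e z.1) U₀ :=
    (contMDiffOn_extChartAt (I := 𝓡 4) (x := p) (n := ∞)).comp
      (contMDiff_subtype_val (I := 𝓡 4) (n := ∞) (U := punctured p)).contMDiffOn
      (fun z hz => hz)
  -- `Φ` vanishes off `K`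
  have hzero : ∀ w : punctured p, w ∉ K → Φ w = 0 := by
    intro w hw
    by_cases hws : w.1 ∈ (chartAt (EuclideanSpace ℝ (Fin 4)) p).source
    · have hsrc : w.1 ∈ e.source := by rw [he, extChartAt_source]; exact hws
      have hfar : R ≤ dist (e w.1 - c) 0 := by
        rw [dist_zero_right, ← dist_eq_norm]
        exact not_lt.1 fun hlt =>
          hw (Set.mem_preimage.2 ⟨e w.1, mem_closedBall.2 hlt.le, e.left_inv hsrc⟩)
      have hχ0 : χ (e w.1 - c) = 0 := χ.zero_of_le_dist hfar
      simp only [Φ, Ψ, if_pos hws, hχ0, zero_smul]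
    · simp only [Φ, if_neg hws]
  refine ⟨R / 2, Φ, by positivity, ?_, ?_⟩
  · -- smoothness, pointwise
    intro z
    by_cases hz : z ∈ U₀
    · -- on the punctured chart source `Φ = Ψ ∘ e`, a smooth composition
      have hzs : z.1 ∈ (chartAt (EuclideanSpace ℝ (Fin 4)) p).source := hz
      have hsrc : z.1 ∈ e.source := by rw [he, extChartAt_source]; exact hzs
      have hne : e z.1 - c ≠ 0 := by
        intro h0
        have h1 : e z.1 = e p := sub_eq_zero.1 h0
        exact (mem_punctured.1 z.2) (e.injOn hsrc (mem_extChartAt_source (I := 𝓡 4) p) h1)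
      have hsub : ContDiffAt ℝ ∞ (fun y : EuclideanSpace ℝ (Fin 4) => y - c) (e z.1) :=
        contDiffAt_id.sub contDiffAt_const
      have h1 : ContDiffAt ℝ ∞ ((χ : EuclideanSpace ℝ (Fin 4) → ℝ) ∘ fun y => y - c) (e z.1) :=
        ContDiffAt.comp (e z.1) (g := (χ : EuclideanSpace ℝ (Fin 4) → ℝ)) (f := fun y => y - c)
          χ.contDiffAt hsub
      have h2 : ContDiffAt ℝ ∞ (inversion ∘ fun y => y - c) (e z.1) :=
        ContDiffAt.comp (e z.1) (g := inversion) (f := fun y => y - c)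
          (contDiffAt_inversion hne) hsub
      have hΨ : ContDiffAt ℝ ∞ Ψ (e z.1) := h1.smul h2
      have hEz : ContMDiffAt (𝓡 4) 𝓘(ℝ, EuclideanSpace ℝ (Fin 4)) ∞
          (fun w : punctured p => e w.1) z :=
        (hE z hz).contMDiffAt (hU₀.mem_nhds hz)
      have hcomp : ContMDiffAt (𝓡 4) 𝓘(ℝ, EuclideanSpace ℝ (Fin 4)) ∞
          (Ψ ∘ fun w : punctured p => e w.1) z :=
        ContDiffAt.comp_contMDiffAt (f := fun w : punctured p => e w.1) (x := z) hΨ hEz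
      refine hcomp.congr_of_eventuallyEq ?_
      filter_upwards [hU₀.mem_nhds hz] with w hw
      have hws : w.1 ∈ (chartAt (EuclideanSpace ℝ (Fin 4)) p).source := hw
      simp only [Φ, Function.comp_apply, if_pos hws]
    · -- off the punctured chart source `Φ` vanishes near `z` (`K ⊆ U₀` is closed)
      have hzK : z ∉ K := by
        intro hzK
        rw [Set.mem_preimage, Set.mem_image] at hzK
        obtain ⟨y, hy, hyz⟩ := hzK
        apply hz
        have h1 : e.symm y ∈ e.source := e.map_target (hRt hy)
        rw [hyz, he, extChartAt_source] at h1
        exact h1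
      refine (contMDiffAt_const (c := (0 : EuclideanSpace ℝ (Fin 4)))).congr_of_eventuallyEq ?_
      filter_upwards [hK.isOpen_compl.mem_nhds hzK] with w hw
      exact hzero w hw
  · -- agreement with `ι ∘ (e − e p)` on the punctured ball of radius `R/2`
    intro x hx
    have hx1 : x.1 ∈ (chartAt (EuclideanSpace ℝ (Fin 4)) p).source := hx.1
    have hx2 : e x.1 ∈ ball c (R / 2) := hx.2
    have hχ1 : χ (e x.1 - c) = 1 := χ.one_of_mem_closedBall (by
      rw [mem_closedBall, dist_zero_right, ← dist_eq_norm]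
      exact (mem_ball.1 hx2).le)
    simp only [Φ, Ψ, if_pos hx1, hχ1, one_smul]

/-- **The closed model extension, for any smooth Hausdorff 4-manifold.** For `p ∈ M` there are
`ε₀ > 0` and a smooth closed `2`-form `α₀` on `M ∖ {p}` which on the punctured chart-ball of
radius `ε₀` at `p` equals the inverted-chart model `(ι*ω₀)_{e x − e p}(De_x v, De_x w)`:
`α₀ = Φ*ω₀` for the cut-off inverted chart `Φ` of
`exists_contMDiff_eq_inversion_of_inPuncturedChartBall` (smooth and closed by Warner 2.22–2.23 and
`dω₀ = 0`; the model identity by the chain rule `dΦ_x = Dι(e x − e p) ∘ De_x` on the open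
punctured ball, as in `isSymplecticStandardNearPoint_pullback`). [cite: Gromov1985, §0.3.C] -/
theorem exists_isClosedForm_eq_invertedStdForm (p : M) :
    ∃ ε₀ : ℝ, 0 < ε₀ ∧ ∃ α₀ : MForm (𝓡 4) (punctured p) ℝ 2,
      IsSmoothForm α₀ ∧ IsClosedForm α₀ ∧
      ∀ x : punctured p, InPuncturedChartBall p ε₀ x → ∀ v w : TangentSpace (𝓡 4) x,
        α₀ x ![v, w] = invertedStdForm (extChartAt (𝓡 4) p x.1 - extChartAt (𝓡 4) p p)
          (mfderiv (𝓡 4) 𝓘(ℝ, EuclideanSpace ℝ (Fin 4))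
            (fun z : punctured p => extChartAt (𝓡 4) p z.1) x v)
          (mfderiv (𝓡 4) 𝓘(ℝ, EuclideanSpace ℝ (Fin 4))
            (fun z : punctured p => extChartAt (𝓡 4) p z.1) x w) := by
  obtain ⟨ε, Φ, hε, hΦs, hΦ⟩ := exists_contMDiff_eq_inversion_of_inPuncturedChartBall p
  refine ⟨ε, hε, stdSymplecticMForm.pullback (𝓡 4) Φ, isSmoothForm_stdSymplecticMForm_pullback hΦs,
    isClosedForm_stdSymplecticMForm_pullback hΦs, ?_⟩
  intro x hx v w
  have hev : Φ =ᶠ[𝓝 x]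
      fun z : punctured p => inversion (extChartAt (𝓡 4) p z.1 - extChartAt (𝓡 4) p p) :=
    Filter.eventuallyEq_of_mem ((isOpen_setOf_inPuncturedChartBall p ε).mem_nhds hx)
      fun z hz => hΦ z hz
  have hΦ' := (hasMFDerivAt_inversion_extChartAt_sub p x hx.1).congr_of_eventuallyEq hev
  rw [stdSymplecticMForm_pullback_apply, hΦ'.mfderiv]
  rfl

end SullivanDual

/-- Settles stmt-SmoothPoincare4-7829 (`SullivanDual.ClosedModelExtension`): for every homotopy
4-sphere `Σ` and `p ∈ Σ` there are `ε₀ > 0` and a smooth closed `2`-form on `Σ ∖ p` equal on the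
punctured `ε₀`-chart-ball to the inverted-chart model `(ι*ω₀)_{e x − e p}(De_x ·, De_x ·)` — the
pull-back of `ω₀` along a smooth cut-off of the inverted recentred chart
(`SullivanDual.exists_isClosedForm_eq_invertedStdForm`, valid on any smooth Hausdorff
4-manifold). [cite: Gromov1985, §0.3.C] -/
theorem ClosedModelExtension_proof :
    Summit.SmoothPoincare4.SmoothPoincare4.Theses.SullivanDual.ClosedModelExtension := by
  unfold Summit.SmoothPoincare4.SmoothPoincare4.Theses.SullivanDual.ClosedModelExtension
  intro S p
  exact SullivanDual.exists_isClosedForm_eq_invertedStdForm p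

end Summit.SmoothPoincare4.SmoothPoincare4.Theorems

end
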